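import Summits.CriticalPhenomena.PercolationContinuityZ3.Theorems.PercNearOneGluingNoHeavyQuantGatedCatHull
import HarnessLib

/-!
# QUANT lane R8, T-DEC: THE OFFSET VALUE BOUND ("Bellman certificate") FOR THE GATED CATERPILLAR HULL — a linear functional `ψ` is
# bounded on EVERY hull member with support in `S` once a table `Z(u, G, A)` dominates the caterpillar recursion offset by offset

builds on p205010 (kernel theorem, internal audit signed; external expert review pending)

Support file (`--supports stmt-CriticalPhenomena-4575`), QUANT lane census seat prim-quant-census-2 (gen 78), rung R8 of
`run/shared/lean/prim/quant/LADDER.md`.  One `Prop`-valued structure (`CatValueBound`, the certificate format) and theorems; standard axioms,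
no sorries.

WHY.  Census-2 g77 (memo `run/shared/lean/prim/quant/prim-quant-census-2-g77/CENSUS-PAIRMAP-G77.md` §4) certified NUMERICALLY that the light glued
pair `lpT 4 (3/5) (49/60)` lies OUTSIDE the gated caterpillar hull `InGatedCatHull (39/80) (128/25) 10` (exact dual `ψ` + branch-and-bound over the 189
support-admissible caterpillar families), whence `TreeBuiltCatHullLight` / `CatPairLight` are false as typed (`…QuantLightPairTreeBuilt`,
`not_treeBuiltCatHullLight_of_corner_out`).  A KERNEL negation needs "`ψ · C ≤ z` for EVERY admissible column `C`".  This file reduces that universal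
statement to FINITELY MANY local inequalities on an explicit table, by an induction on `CatBuilt` that follows the construction of a caterpillar one
operation at a time (census-2 g78, memo `run/shared/lean/prim/quant/prim-quant-census-2-g78/BELLMAN-G78.md`):
* `offFun ψ N μ u = Σ_{h ≤ N} ψ(u + h)·μ h` — the functional read at OFFSET `u` (the relays already collected above the sub-caterpillar);
  `offFun_slice`, `offFun_gate`, `offFun_nil` — how it transforms under the three constructors;
* `CatValueBound S ψ y B Z` — the certificate format: `Z : ℕ → ℝ → ℝ → ℝ` (offset `u`, reach probability `G ∈ (y, 1]` of the spine vertex above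
  the sub-caterpillar, ABSOLUTE mean `A = G·mean`) with (i) `0 ≤ Z u G 0` (tip), (ii) `Z` nondecreasing in `G` (this IS the gate rule: a gate only lowers
  the reach), (iii) the SHIFT rule `Z (u+a) G A + G(ψ(u+a) − ψ u) ≤ Z u G (A + G a)` (a sure blob of `a` relays), (iv) the LEAF rule for a blob of `a`
  relays with gate `g < 1` hung beside a sub-caterpillar `ν` — stated for ALL `ν` whose support fits at BOTH offsets `u` and `u + a` (for a sparse `S`
  this forces `ν` into a tiny explicit class, discharged by the classification lemmas of `…QuantCatHullTinySupport`);
* **`CatValueBound.bound`**: for every `CatBuilt x N μ`, every reach `G` with `y ≤ G·x`, `G ≤ 1`, and every offset `u` with `u + supp μ ⊆ S`: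
  `G·(offFun ψ N μ u − ψ u) ≤ Z u G (G · mean μ)` (induction on `CatBuilt`; floor-lowering is free because the admissible reaches shrink);
* **`CatValueBound.hull`**: every member `μ₀` of `InGatedCatHull y T M` with `supp μ₀ ⊆ S` has `Σ ψ h·μ₀ h ≤ ψ 0 + Z 0 1 T` (each column of positive
  weight is `CatBuilt` at floor `y` with support inside `supp μ₀`); **`not_inGatedCatHull_of_valueBound`**: a table with `ψ 0 + Z 0 1 T < Σ ψ h·μ₀ h`
  EXCLUDES `μ₀` from the hull.
The numerical fact behind the design: for `S = supp lpT = {0,1,2,5,6,10}` the least such `Z` evaluated at `(0, 1, 128/25)` reproduces census-2 g77's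
separation margin `2.69·10⁻³` (third independent computation, census-2 g78 engine `work/dp/vstar2.py`).
HONEST STATUS.  Certificate FORMAT and its soundness only; no table is supplied here, nothing is refuted here; `TreeBuiltCatHullLight`, `CatPairLight`,
`SiblingStep`, `FarTreeRow` keep their ledger status; RATE class log\* / honest sentence of `run/shared/lean/prim/quant/README.md` unchanged.  [this work];
hull and caterpillars: prim-quant-census-2 g74 / prim-quant-stmt g41 (`…QuantGatedCatHull`).  Nothing here is cited as a published result.  The gluing rows
served [cite: KozmaNitzan2024, Conjecture 3 (p. 15)]; product measure [cite: Grimmett1999, §1.3 p. 10].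
-/

noncomputable section

open scoped BigOperators

namespace Summit.CriticalPhenomena.PercolationContinuityZ3.Theorems
namespace Quant
namespace LawDec

open Finset

/-! ### The offset functional -/

/-- **the functional `ψ` read at offset `u`**: `offFun ψ N μ u = Σ_{h ≤ N} ψ (u + h) · μ h`. [this work] -/
def offFun (ψ : ℕ → ℝ) (N : ℕ) (μ : ℕ → ℝ) (u : ℕ) : ℝ := ∑ h ∈ Finset.range (N + 1), ψ (u + h) * μ h

/-- the mean `Σ_{h ≤ N} h · μ h` (the inline convention of `…QuantGatedCatHull`, named). [this work] -/
def lmean (N : ℕ) (μ : ℕ → ℝ) : ℝ := ∑ h ∈ Finset.range (N + 1), (h : ℝ) * μ h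

/-- `offFun` does not see atoms above the top: extending the range changes nothing. [this work] -/
theorem offFun_extend (ψ : ℕ → ℝ) (N a : ℕ) (μ : ℕ → ℝ) (hμ : ∀ h, N < h → μ h = 0) (u : ℕ) :
    offFun ψ (N + a) μ u = offFun ψ N μ u := by
  unfold offFun
  exact sum_range_extend (fun h => ψ (u + h) * μ h) N a (fun h hh => by rw [hμ h hh, mul_zero])

/-- `offFun` of the tip `δ₀` is `ψ u`. [this work] -/
theorem offFun_nil (ψ : ℕ → ℝ) (u : ℕ) : offFun ψ 0 (fun h => if h = 0 then (1 : ℝ) else 0) u = ψ u := by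
  simp [offFun]

/-- `offFun` of a gated law: `q · offFun + (1 − q) · ψ u`. [this work] -/
theorem offFun_gate (ψ : ℕ → ℝ) (N : ℕ) (μ : ℕ → ℝ) (q : ℝ) (u : ℕ) :
    offFun ψ N (gate μ q) u = q * offFun ψ N μ u + (1 - q) * ψ u := by
  unfold offFun
  simp only [gate]
  have e : ∀ h : ℕ, ψ (u + h) * (q * μ h + (if h = 0 then 1 - q else 0))
      = q * (ψ (u + h) * μ h) + (if h = 0 then (1 - q) * ψ u else 0) := by
    intro h
    split_ifs with h0
    · rw [h0, add_zero]; ring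
    · ring
  simp_rw [e]
  rw [Finset.sum_add_distrib, ← Finset.mul_sum, Finset.sum_ite_eq' (Finset.range (N + 1)) 0,
    if_pos (Finset.mem_range.2 (Nat.succ_pos N))]

/-- `offFun` of a slice: `(1 − g) · offFun u + g · offFun (u + a)`. [this work] -/
theorem offFun_slice (ψ : ℕ → ℝ) (N : ℕ) (μ : ℕ → ℝ) (a : ℕ) (g : ℝ) (hμ : ∀ h, N < h → μ h = 0) (u : ℕ) :
    offFun ψ (N + a) (slice μ a g) u = (1 - g) * offFun ψ N μ u + g * offFun ψ N μ (u + a) := by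
  unfold offFun
  simp only [slice]
  have e : ∀ h : ℕ, ψ (u + h) * ((1 - g) * μ h + g * (if a ≤ h then μ (h - a) else 0))
      = (1 - g) * (ψ (u + h) * μ h) + g * (if a ≤ h then ψ (u + a + (h - a)) * μ (h - a) else 0) := by
    intro h
    split_ifs with hah
    · rw [show u + a + (h - a) = u + h by omega]; ring
    · ring
  simp_rw [e]
  rw [Finset.sum_add_distrib, ← Finset.mul_sum, ← Finset.mul_sum,
    sum_range_extend (fun h => ψ (u + h) * μ h) N a (fun h hh => by rw [hμ h hh, mul_zero]),
    sum_shift (fun k => ψ (u + a + k) * μ k) N a]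

/-- mean of a slice (named form of `sum_mul_slice`). [this work] -/
theorem lmean_slice (N : ℕ) (μ : ℕ → ℝ) (a : ℕ) (g : ℝ) (hμM : ∀ h, N < h → μ h = 0)
    (hμ1 : ∑ h ∈ Finset.range (N + 1), μ h = 1) : lmean (N + a) (slice μ a g) = lmean N μ + (a : ℝ) * g := by
  unfold lmean; exact sum_mul_slice μ a g N hμM hμ1

/-- mean of a gated law (named form of `sum_mul_gate`). [this work] -/
theorem lmean_gate (N : ℕ) (μ : ℕ → ℝ) (q : ℝ) : lmean N (gate μ q) = q * lmean N μ := by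
  unfold lmean; exact sum_mul_gate μ q N

/-- a law supported inside `u + · ∈ S` with `S ≤ B` has mean `≤ B − u` (mass `1`, nonnegative). [this work] -/
theorem lmean_le_of_supp {S : Finset ℕ} {B : ℝ} (hB : ∀ s ∈ S, (s : ℝ) ≤ B) {N : ℕ} {μ : ℕ → ℝ} (hμ0 : ∀ h, 0 ≤ μ h)
    (hμ1 : ∑ h ∈ Finset.range (N + 1), μ h = 1) {u : ℕ} (hsupp : ∀ h, μ h ≠ 0 → u + h ∈ S) :
    lmean N μ ≤ B - u := by
  unfold lmean
  calc ∑ h ∈ Finset.range (N + 1), (h : ℝ) * μ h ≤ ∑ h ∈ Finset.range (N + 1), (B - u) * μ h := by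
        refine Finset.sum_le_sum fun h _ => ?_
        by_cases hz : μ h = 0
        · rw [hz, mul_zero, mul_zero]
        · have hs := hB _ (hsupp h hz)
          push_cast at hs
          exact mul_le_mul_of_nonneg_right (by linarith) (hμ0 h)
    _ = B - u := by rw [← Finset.mul_sum, hμ1, mul_one]

/-- the mean is nonnegative. [this work] -/
theorem lmean_nonneg {N : ℕ} {μ : ℕ → ℝ} (hμ0 : ∀ h, 0 ≤ μ h) : 0 ≤ lmean N μ :=
  Finset.sum_nonneg fun h _ => mul_nonneg (Nat.cast_nonneg h) (hμ0 h)

/-! ### The certificate format -/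

/-- **OFFSET VALUE BOUND (Bellman supersolution) for support `S`, functional `ψ`, floor `y`, atom bound `B`.**  `Z u G A` is meant to dominate
`G·(offFun ψ N μ u − ψ u)` for every caterpillar law `μ` at floor `y/G` with `G·mean μ = A` whose support fits in `S` at offset `u`; the four fields are
exactly what the four constructors of `CatBuilt` need (`CatValueBound.bound`).  `tip`: the tip `δ₀`; `mono`: a gate multiplies the reach by `q ≤ 1`
and keeps the absolute mean; `shift`: a sure blob of `a` relays moves the offset; `leaf`: a blob of `a` relays with gate `g < 1` — then the
sub-caterpillar's support must fit at both offsets `u` and `u + a`. [this work] -/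
structure CatValueBound (S : Finset ℕ) (ψ : ℕ → ℝ) (y B : ℝ) (Z : ℕ → ℝ → ℝ → ℝ) : Prop where
  tip : ∀ u ∈ S, ∀ G : ℝ, y < G → G ≤ 1 → 0 ≤ Z u G 0
  mono : ∀ (u : ℕ) (G G' A : ℝ), y < G → G ≤ G' → G' ≤ 1 → 0 ≤ A → A ≤ G * (B - u) → Z u G A ≤ Z u G' A
  shift : ∀ (u a : ℕ) (G A : ℝ), 1 ≤ a → y < G → G ≤ 1 → 0 ≤ A → A ≤ G * (B - (u + a : ℕ)) →
    Z (u + a) G A + G * (ψ (u + a) - ψ u) ≤ Z u G (A + G * a)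
  leaf : ∀ (u a : ℕ) (G g x : ℝ) (N : ℕ) (ν : ℕ → ℝ), 1 ≤ a → y < G → G ≤ 1 → y ≤ G * x → x ≤ g → g < 1 → CatBuilt x N ν →
    (∀ h, ν h ≠ 0 → u + h ∈ S ∧ u + a + h ∈ S) →
    G * ((1 - g) * offFun ψ N ν u + g * offFun ψ N ν (u + a) - ψ u) ≤ Z u G (G * (lmean N ν + a * g))

namespace CatValueBound

variable {S : Finset ℕ} {ψ : ℕ → ℝ} {y B : ℝ} {Z : ℕ → ℝ → ℝ → ℝ}

/-- **THE BOUND ALONG THE CATERPILLAR RECURSION.**  For a certificate `Z`, every `CatBuilt x N μ`, every reach `G` with `y ≤ G·x` (so every relay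
marginal of the reached sub-caterpillar is `≥ y`), `G ≤ 1`, and every offset `u` at which the support of `μ` fits in `S`:
`G · (offFun ψ N μ u − ψ u) ≤ Z u G (G · mean μ)`.  Induction on `CatBuilt`: `nil` is `tip`; `mono` (floor lowering) only shrinks the admissible
reaches; `gate q` passes to the reach `G·q` and uses `mono`; `slice a g` is `shift` (`g = 1`) or `leaf` (`g < 1`). [this work] -/
theorem bound (hZ : CatValueBound S ψ y B Z) (hy : 0 < y) (hB : ∀ s ∈ S, (s : ℝ) ≤ B) {x : ℝ} {N : ℕ} {μ : ℕ → ℝ}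
    (hμ : CatBuilt x N μ) :
    ∀ G : ℝ, y ≤ G * x → G ≤ 1 → ∀ u : ℕ, (∀ h, μ h ≠ 0 → u + h ∈ S) →
      G * (offFun ψ N μ u - ψ u) ≤ Z u G (G * lmean N μ) := by
  induction hμ with
  | nil x₀ hx0 hx1 =>
    intro G hGx hG1 u hsupp
    have hyG : y < G := by nlinarith
    have hu : u ∈ S := by simpa using hsupp 0 (by simp)
    rw [offFun_nil, sub_self, mul_zero]
    have hm : lmean 0 (fun h => if h = 0 then (1 : ℝ) else 0) = 0 := by simp [lmean]
    rw [hm, mul_zero]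
    exact hZ.tip u hu G hyG hG1
  | @slice x₀ M₀ μ₀ h₀ a g hxg hg1 ih =>
    intro G hGx hG1 u hsupp
    obtain ⟨f0, fM, f1, _⟩ := h₀.lawFacts
    have hx0 : 0 < x₀ := h₀.floor.1
    have hyG : y < G := by nlinarith [h₀.floor.2]
    have hG0 : 0 < G := hy.trans hyG
    rw [offFun_slice ψ M₀ μ₀ a g fM u, lmean_slice M₀ μ₀ a g fM f1]
    rcases Nat.eq_zero_or_pos a with ha | ha
    · -- a = 0: the slice is the law itself
      subst ha
      rw [Nat.add_zero, Nat.cast_zero, zero_mul, add_zero, show (1 - g) * offFun ψ M₀ μ₀ u + g * offFun ψ M₀ μ₀ u = offFun ψ M₀ μ₀ u by ring]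
      refine ih G hGx hG1 u fun h hh => hsupp h ?_
      simp only [slice, Nat.zero_le, if_true, Nat.sub_zero]
      intro hc; apply hh; nlinarith [f0 h]
    rcases eq_or_lt_of_le hg1 with hg | hg
    · -- g = 1: a sure blob of `a` relays — the SHIFT rule at offset `u + a`
      subst hg
      have hsupp' : ∀ h, μ₀ h ≠ 0 → u + a + h ∈ S := by
        intro h hh
        have := hsupp (h + a) (by
          simp only [slice, sub_self, zero_mul, zero_add, one_mul, Nat.le_add_left, if_true, Nat.add_sub_cancel]; exact hh)
        rwa [show u + (h + a) = u + a + h by omega] at this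
      have key := ih G hGx hG1 (u + a) hsupp'
      have hA0 : 0 ≤ G * lmean M₀ μ₀ := mul_nonneg hG0.le (lmean_nonneg f0)
      have hAB : G * lmean M₀ μ₀ ≤ G * (B - (u + a : ℕ)) := mul_le_mul_of_nonneg_left (lmean_le_of_supp hB f0 f1 hsupp') hG0.le
      have hs := hZ.shift u a G (G * lmean M₀ μ₀) ha hyG hG1 hA0 hAB
      have e : G * (lmean M₀ μ₀ + (a : ℝ) * 1) = G * lmean M₀ μ₀ + G * a := by ring
      rw [e]
      nlinarith [key, hs]
    · -- x ≤ g < 1: the LEAF rule; the support of μ₀ fits at both offsets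
      have hg0 : 0 < g := hx0.trans_le hxg
      have hsupp' : ∀ h, μ₀ h ≠ 0 → u + h ∈ S ∧ u + a + h ∈ S := by
        intro h hh
        have hpos : 0 < μ₀ h := lt_of_le_of_ne (f0 h) (Ne.symm hh)
        refine ⟨hsupp h ?_, ?_⟩
        · have : (1 - g) * μ₀ h ≤ slice μ₀ a g h := by
            simp only [slice]
            have : 0 ≤ g * (if a ≤ h then μ₀ (h - a) else 0) := mul_nonneg hg0.le (by split_ifs; exacts [f0 _, le_rfl])
            linarith
          intro hc; nlinarith
        · have := hsupp (h + a) (by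
            simp only [slice, Nat.le_add_left, if_true, Nat.add_sub_cancel]
            intro hc; nlinarith [f0 (h + a)])
          rwa [show u + (h + a) = u + a + h by omega] at this
      have key := hZ.leaf u a G g x₀ M₀ μ₀ ha hyG hG1 hGx hxg hg h₀ hsupp'
      have e : G * ((1 - g) * offFun ψ M₀ μ₀ u + g * offFun ψ M₀ μ₀ (u + a) - ψ u)
          = G * ((1 - g) * offFun ψ M₀ μ₀ u + g * offFun ψ M₀ μ₀ (u + a)) - G * ψ u := by ring
      linarith [key]
  | @gate x₀ M₀ μ₀ h₀ q hq0 hq1 ih =>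
    intro G hGx hG1 u hsupp
    obtain ⟨f0, fM, f1, _⟩ := h₀.lawFacts
    have hx0 : 0 < x₀ := h₀.floor.1
    have hqx : q * x₀ < 1 := lt_of_le_of_lt (mul_le_of_le_one_left hx0.le hq1) h₀.floor.2
    have hqx0 : 0 < q * x₀ := mul_pos hq0 hx0
    have hG0 : 0 < G := by
      rcases le_or_gt G 0 with hle | hgt
      · nlinarith [mul_nonpos_of_nonpos_of_nonneg hle hqx0.le]
      · exact hgt
    have hyG : y < G := lt_of_le_of_lt hGx (by nlinarith [mul_lt_mul_of_pos_left hqx hG0])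
    rw [offFun_gate, lmean_gate]
    -- the sub-caterpillar is reached with probability G·q
    have hGq : y ≤ G * q * x₀ := by rw [mul_assoc]; exact hGx
    have hGq1 : G * q ≤ 1 := (mul_le_of_le_one_right hG0.le hq1).trans hG1
    have hsupp' : ∀ h, μ₀ h ≠ 0 → u + h ∈ S := by
      intro h hh
      refine hsupp h ?_
      have hpos : 0 < μ₀ h := lt_of_le_of_ne (f0 h) (Ne.symm hh)
      simp only [gate]
      have : 0 ≤ (if h = 0 then 1 - q else 0 : ℝ) := by split_ifs <;> linarith
      intro hc; nlinarith
    have key := ih (G * q) hGq hGq1 u hsupp'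
    have hA0 : 0 ≤ G * q * lmean M₀ μ₀ := mul_nonneg (mul_nonneg hG0.le hq0.le) (lmean_nonneg f0)
    have hAB : G * q * lmean M₀ μ₀ ≤ G * q * (B - u) := mul_le_mul_of_nonneg_left (lmean_le_of_supp hB f0 f1 hsupp') (mul_nonneg hG0.le hq0.le)
    have hyGq : y < G * q := lt_of_le_of_lt hGq (by nlinarith [mul_lt_mul_of_pos_left h₀.floor.2 (mul_pos hG0 hq0)])
    have hm := hZ.mono u (G * q) G (G * q * lmean M₀ μ₀) hyGq (mul_le_of_le_one_right hG0.le hq1) hG1 hA0 hAB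
    have e1 : G * (q * offFun ψ M₀ μ₀ u + (1 - q) * ψ u - ψ u) = G * q * (offFun ψ M₀ μ₀ u - ψ u) := by ring
    have e2 : G * (q * lmean M₀ μ₀) = G * q * lmean M₀ μ₀ := by ring
    rw [e1, e2]
    exact key.trans hm
  | @mono x₀ x' M₀ μ₀ h₀ hx'0 hxx ih =>
    intro G hGx hG1 u hsupp
    have hG0 : 0 ≤ G := by
      rcases le_or_gt 0 G with hle | hgt
      · exact hle
      · have : G * x' ≤ 0 := mul_nonpos_of_nonpos_of_nonneg hgt.le hx'0.le
        linarith
    exact ih G (hGx.trans (mul_le_mul_of_nonneg_left hxx hG0)) hG1 u hsupp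

/-- **THE HULL BOUND.**  For a certificate `Z` and a member `μ₀` of `InGatedCatHull y T M` whose support lies in `S`:
`Σ_{h ≤ M} ψ h · μ₀ h ≤ ψ 0 + Z 0 1 T` — every column of positive weight is a gated caterpillar, i.e. `CatBuilt` at floor `y` (`CatBuilt.gate`),
of mean `T`, with support inside `supp μ₀ ⊆ S`; apply `bound` with reach `G = 1` at offset `0` and average. [this work] -/
theorem hull (hZ : CatValueBound S ψ y B Z) (hy : 0 < y) (hB : ∀ s ∈ S, (s : ℝ) ≤ B) {T : ℝ} {M : ℕ} {μ₀ : ℕ → ℝ}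
    (hμ₀ : InGatedCatHull y T M μ₀) (hS : ∀ h, μ₀ h ≠ 0 → h ∈ S) :
    ∑ h ∈ Finset.range (M + 1), ψ h * μ₀ h ≤ ψ 0 + Z 0 1 T := by
  obtain ⟨ι, hι, w, s, N, P, hw0, hw1, hs, hC, hNM, hmean, hmix⟩ := hμ₀
  -- law facts of the columns
  have hs0 : ∀ i, 0 < s i := fun i => hy.trans (hs i).1
  have Pf : ∀ i, (∀ k, 0 ≤ P i k) ∧ (∀ k, N i < k → P i k = 0) ∧ ∑ k ∈ Finset.range (N i + 1), P i k = 1 :=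
    fun i => ⟨(hC i).lawFacts.1, (hC i).lawFacts.2.1, (hC i).lawFacts.2.2.1⟩
  have Gf : ∀ i, (∀ k, 0 ≤ gate (P i) (s i) k) ∧ (∀ k, N i < k → gate (P i) (s i) k = 0) ∧
      ∑ k ∈ Finset.range (N i + 1), gate (P i) (s i) k = 1 :=
    fun i => gate_laws (N i) (P i) (s i) (hs0 i).le (hs i).2 (Pf i).1 (Pf i).2.1 (Pf i).2.2
  -- each column is CatBuilt at floor y, of mean T
  have hcat : ∀ i, CatBuilt y (N i) (gate (P i) (s i)) := by
    intro i
    have := CatBuilt.gate (hC i) (s i) (hs0 i) (hs i).2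
    rwa [mul_div_cancel₀ _ (hs0 i).ne'] at this
  have hmeanT : ∀ i, lmean (N i) (gate (P i) (s i)) = T := by
    intro i; rw [lmean_gate]; exact hmean i
  -- columns of positive weight have support inside S
  have hsuppC : ∀ i, 0 < w i → ∀ h, gate (P i) (s i) h ≠ 0 → 0 + h ∈ S := by
    intro i hwi h hh
    rw [zero_add]
    refine hS h ?_
    have hpos : 0 < gate (P i) (s i) h := lt_of_le_of_ne ((Gf i).1 h) (Ne.symm hh)
    rw [hmix h]
    have : w i * gate (P i) (s i) h ≤ ∑ j, w j * gate (P j) (s j) h :=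
      Finset.single_le_sum (f := fun j => w j * gate (P j) (s j) h) (fun j _ => mul_nonneg (hw0 j) ((Gf j).1 h)) (Finset.mem_univ i)
    intro hc; nlinarith [mul_pos hwi hpos]
  -- per-column bound
  have hcol : ∀ i, w i * offFun ψ M (gate (P i) (s i)) 0 ≤ w i * (ψ 0 + Z 0 1 T) := by
    intro i
    rcases eq_or_lt_of_le (hw0 i) with hz | hpos
    · rw [← hz, zero_mul, zero_mul]
    · refine mul_le_mul_of_nonneg_left ?_ (hw0 i)
      obtain ⟨d, hd⟩ := Nat.exists_eq_add_of_le (hNM i)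
      rw [hd, offFun_extend ψ (N i) d _ (Gf i).2.1]
      have key := hZ.bound hy hB (hcat i) 1 (by rw [one_mul]) le_rfl 0 (hsuppC i hpos)
      rw [one_mul, one_mul, hmeanT i] at key
      linarith
  -- assemble
  have e : ∑ h ∈ Finset.range (M + 1), ψ h * μ₀ h = ∑ i, w i * offFun ψ M (gate (P i) (s i)) 0 := by
    unfold offFun
    simp_rw [zero_add, Finset.mul_sum]
    rw [Finset.sum_comm]
    refine Finset.sum_congr rfl fun h _ => ?_
    rw [hmix h, Finset.mul_sum]
    exact Finset.sum_congr rfl fun i _ => by ring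
  rw [e]
  calc ∑ i, w i * offFun ψ M (gate (P i) (s i)) 0 ≤ ∑ i, w i * (ψ 0 + Z 0 1 T) := Finset.sum_le_sum fun i _ => hcol i
    _ = ψ 0 + Z 0 1 T := by rw [← Finset.sum_mul, hw1, one_mul]

end CatValueBound

/-- **EXCLUSION FROM THE HULL BY A CERTIFICATE**: if `μ₀` has support in `S` and a certificate `Z` gives `ψ 0 + Z 0 1 T < Σ ψ h · μ₀ h`, then
`μ₀ ∉ InGatedCatHull y T M`. [this work] -/
theorem not_inGatedCatHull_of_valueBound {S : Finset ℕ} {ψ : ℕ → ℝ} {y B : ℝ} {Z : ℕ → ℝ → ℝ → ℝ} (hZ : CatValueBound S ψ y B Z)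
    (hy : 0 < y) (hB : ∀ s ∈ S, (s : ℝ) ≤ B) {T : ℝ} {M : ℕ} {μ₀ : ℕ → ℝ} (hS : ∀ h, μ₀ h ≠ 0 → h ∈ S)
    (hsep : ψ 0 + Z 0 1 T < ∑ h ∈ Finset.range (M + 1), ψ h * μ₀ h) : ¬ InGatedCatHull y T M μ₀ :=
  fun hmem => absurd (hZ.hull hy hB hmem hS) (not_le.2 hsep)

end LawDec
end Quant
end Summit.CriticalPhenomena.PercolationContinuityZ3.Theorems
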